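import Mathlib
import Summits.ValiantsHypothesis.ValiantsHypothesis.Theorems.LacunarySymmetroidMatrixDescartesCensusRealExponentsSignChanges

/-!
# `MatrixDescartes` census — sign variations of real-exponent pencils along point sequences; the `2 × 2` perturbation identity

HONEST FRAMING.  Object-search cell `pub-symmetroid`, items `DoorA26 = PosRootLawAt 2 6 19`
(stmt-ValiantsHypothesis-19979), `DoorA34 = PosRootLawAt 3 4 18` (stmt-ValiantsHypothesis-19980), OPEN,
typed, never asserted; tools for the real-exponent currency (`…CensusRealExponents*`), deciding nothing.
Nothing here bears on `MatrixDescartes` (stmt-ValiantsHypothesis-18050) or `VP ≠ VNP`.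

* `le_of_signChanges_le` — `le_of_signChanges` with brackets allowed to TOUCH (`b i ≤ a j` for `i < j`);
* `card_signVar_le` — **an integer row bounds the number of SIGN VARIATIONS of every real-exponent pencil
  along every strictly increasing finite sequence of points** (every `B`): if `PosRootLawAt m K B` then
  `#{i : det P_δ(p_i) · det P_δ(p_{i+1}) < 0} ≤ B` for `p₀ < p₁ < ⋯ < p_M` — the form in which alternation
  certificates are written (the cell's `le_card_posRoots_of_alternating` currency, real exponents);
* `det_add_smul_fin_two` — `det(F + εW) = det F + ε·(F₀₀W₁₁ + F₁₁W₀₀ − F₀₁W₁₀ − F₁₀W₀₁) + ε²·det W` for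
  `2 × 2` matrices, and `expPencil_update_zero` — perturbing the letter `S₀` by `εW` perturbs the pencil
  value by `ε e^{δ₀ t} W` (inputs of the non-sharp transfer, companion file).

[folklore] Intermediate value theorem; `2 × 2` determinant expansion.
-/

-- `Summit.ValiantsHypothesis.ValiantsHypothesis.…` repeats a component by the D-0017 layout
-- (single-conjunct summit), which the `dupNamespace` linter flags; the name is mandated.
set_option linter.dupNamespace false

namespace Summit.ValiantsHypothesis.ValiantsHypothesis.Theorems.LacunarySymmetroidMatrixDescartes.Census.RealExp

open Finset Polynomial
open scoped BigOperators Matrix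
open Summit.ValiantsHypothesis.ValiantsHypothesis.Theorems.MatrixDescartes.Negative (PosRootLawAt)
open Summit.ValiantsHypothesis.ValiantsHypothesis.Theorems.SymmetroidDescartes (eval_det_pencil)

section SignVar

variable {m K : ℕ}

/-- `le_of_signChanges` with touching brackets: if `PosRootLawAt m K B`, a real-exponent pencil changes
sign across at most `B` brackets `a i < b i` with `b i ≤ a j` for `i < j`. [folklore] -/
theorem le_of_signChanges_le {B : ℕ} (hlaw : PosRootLawAt m K B) (δ : Fin K → ℝ)
    (S : Fin K → Matrix (Fin m) (Fin m) ℝ) (hS : ∀ l, (S l).IsSymm) {n : ℕ} (a b : Fin n → ℝ)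
    (hab : ∀ i, a i < b i) (hdisj : ∀ i j, i < j → b i ≤ a j)
    (hsign : ∀ i, (∑ l, Real.exp (δ l * a i) • S l).det * (∑ l, Real.exp (δ l * b i) • S l).det < 0) :
    n ≤ B := by
  classical
  rcases Nat.eq_zero_or_pos n with hn0 | hn0
  · omega
  obtain ⟨r, hr, hball⟩ := brackets_persist δ S a b hsign
  set D : ℕ := ⌈1 / r⌉₊ + 1 with hD
  have hD0 : 0 < D := Nat.succ_pos _
  have hDpos : (0 : ℝ) < D := by exact_mod_cast hD0
  have hDr : 1 / (D : ℝ) < r := by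
    have h1 : 1 / r < (D : ℝ) := by
      rw [hD]; push_cast
      exact (Nat.le_ceil (1 / r)).trans_lt (lt_add_one _)
    exact (one_div_lt hDpos hr).mpr h1
  set z : Fin K → ℤ := fun l => ⌊δ l * D⌋ with hz
  have hdist : dist (fun l => (z l : ℝ) / D) δ < r := by
    rw [dist_pi_lt_iff hr]
    intro l
    rw [Real.dist_eq]
    have h1 : (z l : ℝ) ≤ δ l * D := Int.floor_le _
    have h2 : δ l * D < (z l : ℝ) + 1 := Int.lt_floor_add_one _
    have heq : (z l : ℝ) / D - δ l = ((z l : ℝ) - δ l * D) / D := by field_simp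
    have h3 : |(z l : ℝ) / D - δ l| ≤ 1 / D := by
      rw [heq, abs_le]
      constructor
      · rw [le_div_iff₀ hDpos]
        have : -(1 / (D : ℝ)) * D = -1 := by field_simp
        rw [this]; linarith
      · exact div_le_div_of_nonneg_right (by linarith) hDpos.le
    exact h3.trans_lt hDr
  have hsign' := hball (fun l => (z l : ℝ) / D) hdist
  have hzeros : ∀ i, ∃ w ∈ Set.Ioo (a i) (b i),
      (∑ l, Real.exp (((z l : ℝ) / D) * w) • S l).det = 0 :=
    fun i => exists_zero_of_mul_neg (hab i)
      (continuous_det_expPencil (fun l => (z l : ℝ) / D) S).continuousOn (hsign' i)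
  choose w hwmem hw0 using hzeros
  have hwmono : StrictMono w := by
    intro i j hij
    have h1 := (hwmem i).2
    have h2 := (hwmem j).1
    have h3 := hdisj i j hij
    linarith
  obtain ⟨e, he⟩ := exists_nat_support z hD0 S
  set P : ℝ[X] := (∑ l, (X : ℝ[X]) ^ e l • (S l).map C).det with hP
  have hProot : ∀ i, P.eval (Real.exp (w i / D)) = 0 := fun i => by rw [hP, he]; exact hw0 i
  have hPne : P ≠ 0 := by
    intro h0
    have h1 : P.eval (Real.exp (a ⟨0, hn0⟩ / D)) = 0 := by rw [h0, eval_zero]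
    rw [hP, he] at h1
    have h2 := hsign' ⟨0, hn0⟩
    rw [h1, zero_mul] at h2
    exact lt_irrefl 0 h2
  set xs : Fin n → ℝ := fun i => Real.exp (w i / D) with hxs
  have hxsinj : Function.Injective xs := by
    intro i j hij
    have h1 := Real.exp_injective hij
    have h2 : w i = w j := by
      have h3 : w i / D * D = w j / D * D := by rw [h1]
      rwa [div_mul_cancel₀ _ hDpos.ne', div_mul_cancel₀ _ hDpos.ne'] at h3
    exact hwmono.injective h2
  have hsub : univ.image xs ⊆ P.roots.toFinset.filter (fun x => 0 < x) := by
    intro x hx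
    rw [Finset.mem_image] at hx
    obtain ⟨i, -, rfl⟩ := hx
    rw [Finset.mem_filter, Multiset.mem_toFinset, mem_roots hPne, IsRoot.def]
    exact ⟨hProot i, Real.exp_pos _⟩
  have hcard := Finset.card_le_card hsub
  rw [Finset.card_image_of_injective _ hxsinj, Finset.card_univ, Fintype.card_fin] at hcard
  have hle := hlaw e S hS
  rw [← hP] at hle
  omega

/-- **Sign variations along a point sequence are bounded by the integer row (every `B`).**  If
`PosRootLawAt m K B`, then for every real exponent vector `δ`, symmetric letters `S` and strictly
increasing points `p₀ < ⋯ < p_M`, the number of consecutive sign variations of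
`t ↦ det ∑_l e^{δ_l t} S_l` along the sequence is at most `B`. [folklore] -/
theorem card_signVar_le {B : ℕ} (hlaw : PosRootLawAt m K B) (δ : Fin K → ℝ)
    (S : Fin K → Matrix (Fin m) (Fin m) ℝ) (hS : ∀ l, (S l).IsSymm) {M : ℕ} (p : Fin (M + 1) → ℝ)
    (hp : StrictMono p) :
    (univ.filter (fun i : Fin M => (∑ l, Real.exp (δ l * p i.castSucc) • S l).det *
      (∑ l, Real.exp (δ l * p i.succ) • S l).det < 0)).card ≤ B := by
  classical
  obtain ⟨I, hImem⟩ : ∃ I : Finset (Fin M), ∀ i, i ∈ I ↔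
      (∑ l, Real.exp (δ l * p i.castSucc) • S l).det * (∑ l, Real.exp (δ l * p i.succ) • S l).det < 0 :=
    ⟨univ.filter (fun i : Fin M => (∑ l, Real.exp (δ l * p i.castSucc) • S l).det *
      (∑ l, Real.exp (δ l * p i.succ) • S l).det < 0), fun i => by simp⟩
  have hIeq : univ.filter (fun i : Fin M => (∑ l, Real.exp (δ l * p i.castSucc) • S l).det *
      (∑ l, Real.exp (δ l * p i.succ) • S l).det < 0) = I := by
    ext i; simp [hImem]
  rw [hIeq]
  set e := I.orderEmbOfFin rfl with he
  have hemem : ∀ k, e k ∈ I := fun k => Finset.orderEmbOfFin_mem I rfl k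
  have hemono : StrictMono e := (I.orderEmbOfFin rfl).strictMono
  refine le_of_signChanges_le hlaw δ S hS (fun k => p (e k).castSucc) (fun k => p (e k).succ)
    (fun k => hp (Fin.castSucc_lt_succ)) (fun k k' hkk' => ?_) (fun k => (hImem _).mp (hemem k))
  apply hp.monotone
  have h1 : e k < e k' := hemono hkk'
  rw [Fin.le_def, Fin.val_succ, Fin.val_castSucc]
  rw [Fin.lt_def] at h1
  omega

end SignVar

section Perturb

/-- The `2 × 2` determinant of a perturbation: `det(F + εW) = det F + ε·⟨F, W⟩ + ε²·det W` with
`⟨F, W⟩ = F₀₀W₁₁ + F₁₁W₀₀ − F₀₁W₁₀ − F₁₀W₀₁` (`= tr(adj F · W)`). [folklore] -/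
theorem det_add_smul_fin_two (F W : Matrix (Fin 2) (Fin 2) ℝ) (ε : ℝ) :
    (F + ε • W).det = F.det + ε * (F 0 0 * W 1 1 + F 1 1 * W 0 0 - F 0 1 * W 1 0 - F 1 0 * W 0 1) +
      ε ^ 2 * W.det := by
  simp only [Matrix.det_fin_two, Matrix.add_apply, Matrix.smul_apply, smul_eq_mul]
  ring

variable {m K : ℕ}

/-- Perturbing the letter `S₀` by `εW` perturbs the pencil value by `ε e^{δ₀ t}·W`. [folklore] -/
theorem expPencil_update_zero {k : ℕ} (δ : Fin (k + 1) → ℝ) (S : Fin (k + 1) → Matrix (Fin m) (Fin m) ℝ)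
    (W : Matrix (Fin m) (Fin m) ℝ) (ε t : ℝ) :
    (∑ l, Real.exp (δ l * t) • Function.update S 0 (S 0 + ε • W) l) =
      (∑ l, Real.exp (δ l * t) • S l) + (ε * Real.exp (δ 0 * t)) • W := by
  rw [Fin.sum_univ_succ, Fin.sum_univ_succ, Function.update_self]
  have h : ∀ i : Fin k, Function.update S 0 (S 0 + ε • W) i.succ = S i.succ :=
    fun i => Function.update_of_ne (Fin.succ_ne_zero i) _ _
  simp only [h, smul_add, smul_smul]
  rw [mul_comm (Real.exp (δ 0 * t)) ε]
  abel

/-- A perturbed symmetric letter family stays symmetric. [folklore] -/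
theorem isSymm_update_zero {k : ℕ} (S : Fin (k + 1) → Matrix (Fin m) (Fin m) ℝ) (hS : ∀ l, (S l).IsSymm)
    (W : Matrix (Fin m) (Fin m) ℝ) (hW : W.IsSymm) (ε : ℝ) (l : Fin (k + 1)) :
    (Function.update S 0 (S 0 + ε • W) l).IsSymm := by
  rcases eq_or_ne l 0 with rfl | hl
  · rw [Function.update_self]
    exact (hS 0).add (hW.smul ε)
  · rw [Function.update_of_ne hl]
    exact hS l

end Perturb

end Summit.ValiantsHypothesis.ValiantsHypothesis.Theorems.LacunarySymmetroidMatrixDescartes.Census.RealExp
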